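import Literature.MathematicalPhysics.QuantumFieldTheory.Balaban1983to89.B6BoxCharts
import Literature.MathematicalPhysics.QuantumFieldTheory.ShenZhuZhuErgodicity
import HarnessLib

/-!
# The torus weights of Shen–Zhu–Zhu's distance `ρ_(∞,a)` seen through the periodic lift:
# `ρ_(∞,a)(torusLift U, torusLift U')² = Σ_e w_e ρ(U_e,U'_e)²`, `w_e = Σ_(lifts et of e) a^(−|et|)`, with `0 < w_e < ∞` and `w_e ≤ a·w_(e')` on common plaquettes

Seat `ym-line-csu-p1` (g43), route `ColdStartUniversality` of `Summits/QuantumFields/YangMills`, helper file (`--supports stmt-QuantumFields-24809`).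
Pure lattice combinatorics for the named fact `shenZhuZhu_weightedContraction (fundamentalLatticeRep 2) 3` (SZZ Lemma 5.1 "uses periodic extension to
view every measure as a probability on `𝒬`"): the level `|et|` (`edgeLevel`, graph distance in `ℤ³` = `ℓ¹` norm, tree) changes by at most one between
the edges of a unit square, `Σ_et a^(−|et|) < ∞` for `a > 1`, the fibres of `torusEdge L` are the `Lℤ³`-translates of one lift, and the `tsum` defining
`weightedRiemannDistSq` regroups along the fibres.
* `zd_dist_zero_eq`, `zd_dist_zero_add_single_le`, ★ `edgeLevel_square` — levels of the four edges of a unit square differ by at most `1`;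
* ★ `summable_inv_pow_edgeLevel` — `Σ_(et ∈ E⁺(ℤ³)) a^(−|et|) < ∞` (`a^(−|(y,i)|) ≤ a·Π_m a^(−|y_m|)`);
* ★ `tsum_fibre_eq_tsum_lifts` — `Σ_(et ↦ e) f(et) = Σ_(k ∈ ℤ³) f(ỹ + Lk, i)` for any lift `ỹ` of the base point of `e = (x,i)`;
* ★★ `torusWeight_pos`, `torusWeight_plaquette_le`, ★★ `weightedRiemannDistSq_torusLift_eq` — the displayed facts.
THEOREMS ONLY, no definition (the weight is the displayed `tsum` term), no sorry.  HONEST FRAMING: lattice bookkeeping only; nothing about dynamics;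
no crux, rung or summit statement is proved; the Yang–Mills mass gap is NOT proved.
-/

set_option autoImplicit false

noncomputable section

namespace Summit.QuantumFields.YangMills.Theorems.ColdStartUniversality

open Finset Filter Topology Set
open scoped BigOperators
open Literature.MathematicalPhysics.QuantumFieldTheory
open Literature.MathematicalPhysics.QuantumFieldTheory.Balaban1983to89.B6BoxCharts (zdGraph_dist_eq_latL1Dist)

variable {L : ℕ} [NeZero L]

/-! ## §1. Levels of the edges of a unit square -/

omit [NeZero L] in
/-- The graph distance to the origin in `ℤ³` is the `ℓ¹` norm. [folklore] -/
theorem zd_dist_zero_eq (v : (Fin 3 → ℤ)) : (Literature.Probability.LatticeModels.zdGraph 3).dist 0 v = (v 0).natAbs + (v 1).natAbs + (v 2).natAbs := by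
  rw [zdGraph_dist_eq_latL1Dist]; unfold Literature.Probability.LatticeModels.latL1Dist; simp [Fin.sum_univ_three]

omit [NeZero L] in
/-- One unit step changes the distance to the origin by at most one. [folklore] -/
theorem zd_dist_zero_add_single_le (y : (Fin 3 → ℤ)) (i : Fin 3) :
    (Literature.Probability.LatticeModels.zdGraph 3).dist 0 (y + Pi.single i 1) ≤ (Literature.Probability.LatticeModels.zdGraph 3).dist 0 y + 1 ∧ (Literature.Probability.LatticeModels.zdGraph 3).dist 0 y ≤ (Literature.Probability.LatticeModels.zdGraph 3).dist 0 (y + Pi.single i 1) + 1 := by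
  rw [zd_dist_zero_eq, zd_dist_zero_eq]
  fin_cases i <;> simp <;> omega

omit [NeZero L] in
/-- ★ **The levels `|et|` of the four edges `(y,i), (y+eᵢ,j), (y+eⱼ,i), (y,j)` of a unit square of `ℤ³` differ pairwise by at most one.**
[cite: ShenZhuZhuCMP2023, (3.6)] -/
theorem edgeLevel_square (y : (Fin 3 → ℤ)) (i j : Fin 3) :
    (edgeLevel (((y, i)) : Literature.MathematicalPhysics.QuantumLattice.ZdEdge 3) ≤ edgeLevel (((y + Pi.single i 1, j)) : Literature.MathematicalPhysics.QuantumLattice.ZdEdge 3) + 1 ∧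
      edgeLevel (((y, i)) : Literature.MathematicalPhysics.QuantumLattice.ZdEdge 3) ≤ edgeLevel (((y + Pi.single j 1, i)) : Literature.MathematicalPhysics.QuantumLattice.ZdEdge 3) + 1 ∧
      edgeLevel (((y, i)) : Literature.MathematicalPhysics.QuantumLattice.ZdEdge 3) ≤ edgeLevel (((y, j)) : Literature.MathematicalPhysics.QuantumLattice.ZdEdge 3) + 1) ∧
    (edgeLevel (((y + Pi.single i 1, j)) : Literature.MathematicalPhysics.QuantumLattice.ZdEdge 3) ≤ edgeLevel (((y, i)) : Literature.MathematicalPhysics.QuantumLattice.ZdEdge 3) + 1 ∧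
      edgeLevel (((y + Pi.single i 1, j)) : Literature.MathematicalPhysics.QuantumLattice.ZdEdge 3) ≤ edgeLevel (((y + Pi.single j 1, i)) : Literature.MathematicalPhysics.QuantumLattice.ZdEdge 3) + 1 ∧
      edgeLevel (((y + Pi.single i 1, j)) : Literature.MathematicalPhysics.QuantumLattice.ZdEdge 3) ≤ edgeLevel (((y, j)) : Literature.MathematicalPhysics.QuantumLattice.ZdEdge 3) + 1) ∧
    (edgeLevel (((y + Pi.single j 1, i)) : Literature.MathematicalPhysics.QuantumLattice.ZdEdge 3) ≤ edgeLevel (((y, i)) : Literature.MathematicalPhysics.QuantumLattice.ZdEdge 3) + 1 ∧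
      edgeLevel (((y + Pi.single j 1, i)) : Literature.MathematicalPhysics.QuantumLattice.ZdEdge 3) ≤ edgeLevel (((y + Pi.single i 1, j)) : Literature.MathematicalPhysics.QuantumLattice.ZdEdge 3) + 1 ∧
      edgeLevel (((y + Pi.single j 1, i)) : Literature.MathematicalPhysics.QuantumLattice.ZdEdge 3) ≤ edgeLevel (((y, j)) : Literature.MathematicalPhysics.QuantumLattice.ZdEdge 3) + 1) ∧
    (edgeLevel (((y, j)) : Literature.MathematicalPhysics.QuantumLattice.ZdEdge 3) ≤ edgeLevel (((y, i)) : Literature.MathematicalPhysics.QuantumLattice.ZdEdge 3) + 1 ∧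
      edgeLevel (((y, j)) : Literature.MathematicalPhysics.QuantumLattice.ZdEdge 3) ≤ edgeLevel (((y + Pi.single i 1, j)) : Literature.MathematicalPhysics.QuantumLattice.ZdEdge 3) + 1 ∧
      edgeLevel (((y, j)) : Literature.MathematicalPhysics.QuantumLattice.ZdEdge 3) ≤ edgeLevel (((y + Pi.single j 1, i)) : Literature.MathematicalPhysics.QuantumLattice.ZdEdge 3) + 1) := by
  have h1 := zd_dist_zero_add_single_le y i
  have h2 := zd_dist_zero_add_single_le y j
  have h3 := zd_dist_zero_add_single_le (y + Pi.single i 1) j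
  have h4 := zd_dist_zero_add_single_le (y + Pi.single j 1) i
  rw [add_right_comm y (Pi.single j 1) (Pi.single i 1)] at h4
  unfold edgeLevel
  dsimp only
  rw [add_right_comm y (Pi.single j 1) (Pi.single i 1)]
  omega

/-! ## §2. Summability of `a^(−|et|)` over the edges of `ℤ³` -/

omit [NeZero L] in
/-- `‖y‖₁ ≤ |(y,i)| + 1`. [cite: ShenZhuZhuCMP2023, (3.6)] -/
theorem l1_le_edgeLevel_add_one (y : (Fin 3 → ℤ)) (i : Fin 3) :
    (y 0).natAbs + (y 1).natAbs + (y 2).natAbs ≤ edgeLevel (((y, i)) : Literature.MathematicalPhysics.QuantumLattice.ZdEdge 3) + 1 := by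
  have h1 := zd_dist_zero_add_single_le y i
  rw [zd_dist_zero_eq y] at h1
  unfold edgeLevel; dsimp only
  rw [zd_dist_zero_eq y]
  omega

omit [NeZero L] in
/-- `a^(−|(y,i)|) ≤ a · Π_m a^(−|y_m|)` for `a ≥ 1`. [cite: ShenZhuZhuCMP2023, (3.6)] -/
theorem inv_pow_edgeLevel_le {a : ℝ} (ha : 1 ≤ a) (y : (Fin 3 → ℤ)) (i : Fin 3) :
    (a ^ edgeLevel (((y, i)) : Literature.MathematicalPhysics.QuantumLattice.ZdEdge 3))⁻¹ ≤ a * (a⁻¹ ^ (y 0).natAbs * (a⁻¹ ^ (y 1).natAbs * a⁻¹ ^ (y 2).natAbs)) := by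
  have ha0 : 0 < a := by linarith
  have hn := l1_le_edgeLevel_add_one y i
  have hpow : a ^ ((y 0).natAbs + (y 1).natAbs + (y 2).natAbs) ≤ a ^ (edgeLevel (((y, i)) : Literature.MathematicalPhysics.QuantumLattice.ZdEdge 3) + 1) := pow_le_pow_right₀ ha hn
  have h1 : (a ^ edgeLevel (((y, i)) : Literature.MathematicalPhysics.QuantumLattice.ZdEdge 3))⁻¹ = a * (a ^ (edgeLevel (((y, i)) : Literature.MathematicalPhysics.QuantumLattice.ZdEdge 3) + 1))⁻¹ := by
    rw [pow_succ, mul_inv, ← mul_assoc, mul_comm a, mul_assoc, mul_inv_cancel₀ ha0.ne', mul_one]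
  have h2 : a⁻¹ ^ (y 0).natAbs * (a⁻¹ ^ (y 1).natAbs * a⁻¹ ^ (y 2).natAbs) = (a ^ ((y 0).natAbs + (y 1).natAbs + (y 2).natAbs))⁻¹ := by
    rw [← inv_pow, pow_add, pow_add, mul_assoc]
  rw [h1, h2]
  exact mul_le_mul_of_nonneg_left (inv_anti₀ (pow_pos ha0 _) hpow) ha0.le

omit [NeZero L] in
/-- ★ **`Σ_(et ∈ E⁺(ℤ³)) a^(−|et|) < ∞` for `a > 1`** (the series behind `ρ_(∞,a)`: `#{|et| = n}` grows polynomially). [cite: ShenZhuZhuCMP2023, (1.4)] -/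
theorem summable_inv_pow_edgeLevel {a : ℝ} (ha : 1 < a) : Summable (fun et : Literature.MathematicalPhysics.QuantumLattice.ZdEdge 3 => (a ^ edgeLevel et)⁻¹) := by
  have ha0 : 0 < a := by linarith
  have hr0 : 0 ≤ a⁻¹ := inv_nonneg.2 ha0.le
  have hr1 : a⁻¹ < 1 := inv_lt_one_of_one_lt₀ ha
  -- geometric series over `ℤ`
  have hZ : Summable (fun n : ℤ => a⁻¹ ^ n.natAbs) := by
    refine summable_int_iff_summable_nat_and_neg.2 ⟨?_, ?_⟩
    · simpa using summable_geometric_of_lt_one hr0 hr1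
    · simpa using summable_geometric_of_lt_one hr0 hr1
  have hZ0 : 0 ≤ fun n : ℤ => a⁻¹ ^ n.natAbs := fun n => pow_nonneg hr0 _
  have h3 : Summable (fun p : ℤ × (ℤ × ℤ) => a⁻¹ ^ p.1.natAbs * (a⁻¹ ^ p.2.1.natAbs * a⁻¹ ^ p.2.2.natAbs)) :=
    hZ.mul_of_nonneg (hZ.mul_of_nonneg hZ hZ0 hZ0) hZ0 (fun p => mul_nonneg (pow_nonneg hr0 _) (pow_nonneg hr0 _))
  -- transport to `ℤ³ = Fin 3 → ℤ`
  let eS : (ℤ × (ℤ × ℤ)) ≃ (Fin 3 → ℤ) :=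
    { toFun := fun p => ![p.1, p.2.1, p.2.2]
      invFun := fun y => (y 0, y 1, y 2)
      left_inv := fun p => rfl
      right_inv := fun y => by funext m; fin_cases m <;> rfl }
  have hY : Summable (fun y : (Fin 3 → ℤ) => a⁻¹ ^ (y 0).natAbs * (a⁻¹ ^ (y 1).natAbs * a⁻¹ ^ (y 2).natAbs)) := by
    rw [← eS.summable_iff]; exact h3
  have hY3 : Summable (fun y : (Fin 3 → ℤ) => (3 : ℝ) * (a * (a⁻¹ ^ (y 0).natAbs * (a⁻¹ ^ (y 1).natAbs * a⁻¹ ^ (y 2).natAbs)))) :=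
    (hY.mul_left a).mul_left 3
  -- the dominating function on `ℤ³ × Fin 3`
  have hdom : Summable (fun et : Literature.MathematicalPhysics.QuantumLattice.ZdEdge 3 => a * (a⁻¹ ^ (et.1 0).natAbs * (a⁻¹ ^ (et.1 1).natAbs * a⁻¹ ^ (et.1 2).natAbs))) := by
    refine (summable_prod_of_nonneg fun et => by positivity).2 ⟨fun y => Summable.of_finite, ?_⟩
    refine hY3.congr fun y => ?_
    rw [tsum_fintype]; dsimp only
    rw [Finset.sum_const, Finset.card_univ, Fintype.card_fin, nsmul_eq_mul]; norm_num
  refine Summable.of_nonneg_of_le (fun et => inv_nonneg.2 (pow_nonneg ha0.le _)) (fun et => ?_) hdom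
  exact inv_pow_edgeLevel_le ha.le et.1 et.2

/-! ## §3. The fibres of `torusEdge L` are the `Lℤ³`-translates of a lift -/

omit [NeZero L] in
/-- `proj (ỹ + Lk) = proj ỹ`. [folklore] -/
theorem proj_add_smul (yt k : (Fin 3 → ℤ)) : Literature.Probability.LatticeModels.Torus.proj L (yt + (L : ℤ) • k) = Literature.Probability.LatticeModels.Torus.proj L yt := by
  funext m; simp

omit [NeZero L] in
/-- `proj (ỹ + eᵢ) = (proj ỹ).shift i`. [folklore] -/
theorem proj_add_single (yt : (Fin 3 → ℤ)) (i : Fin 3) : Literature.Probability.LatticeModels.Torus.proj L (yt + Pi.single i 1) = Site.shift (Literature.Probability.LatticeModels.Torus.proj L yt) i := by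
  funext m
  unfold Site.shift
  simp only [Literature.Probability.LatticeModels.Torus.proj_apply, Pi.add_apply, Int.cast_add]
  by_cases h : m = i
  · subst h; simp
  · simp [Pi.single_eq_of_ne h]

/-- The canonical lift `x̃_m = val(x_m)` projects to `x`. [folklore] -/
theorem proj_lift_val (x : Site 3 L) : Literature.Probability.LatticeModels.Torus.proj L (fun m => ((x m).val : ℤ)) = x := by
  funext m; simp

/-- ★ **Fibre sums are sums over `ℤ³`**: for `e = (x,i)` and any `ỹ` with `proj ỹ = x`, `k ↦ (ỹ + Lk, i)` is a bijection `ℤ³ ≃ {et : torusEdge et = e}`, so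
`Σ'_(et ↦ e) f et = Σ'_k f(ỹ + Lk, i)` and the two summabilities are equivalent. [folklore] -/
theorem tsum_fibre_eq_tsum_lifts (f : Literature.MathematicalPhysics.QuantumLattice.ZdEdge 3 → ℝ) (x : Site 3 L) (i : Fin 3) (yt : (Fin 3 → ℤ)) (hyt : Literature.Probability.LatticeModels.Torus.proj L yt = x) :
    (∑' et : {et : Literature.MathematicalPhysics.QuantumLattice.ZdEdge 3 // Literature.MathematicalPhysics.QuantumLattice.torusEdge L et = (x, i)}, f et.1) = ∑' k : (Fin 3 → ℤ), f (yt + (L : ℤ) • k, i) ∧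
    (Summable (fun et : {et : Literature.MathematicalPhysics.QuantumLattice.ZdEdge 3 // Literature.MathematicalPhysics.QuantumLattice.torusEdge L et = (x, i)} => f et.1) ↔ Summable (fun k : (Fin 3 → ℤ) => f (yt + (L : ℤ) • k, i))) := by
  have hL : (L : ℤ) ≠ 0 := by exact_mod_cast (NeZero.ne L)
  have hmem : ∀ k : (Fin 3 → ℤ), Literature.MathematicalPhysics.QuantumLattice.torusEdge L (yt + (L : ℤ) • k, i) = (x, i) := fun k => by
    show (Literature.Probability.LatticeModels.Torus.proj L (yt + (L : ℤ) • k), i) = (x, i)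
    rw [proj_add_smul, hyt]
  let g : (Fin 3 → ℤ) → {et : Literature.MathematicalPhysics.QuantumLattice.ZdEdge 3 // Literature.MathematicalPhysics.QuantumLattice.torusEdge L et = (x, i)} := fun k => ⟨(yt + (L : ℤ) • k, i), hmem k⟩
  have hinj : Function.Injective g := by
    intro k k' h
    have h1 : yt + (L : ℤ) • k = yt + (L : ℤ) • k' := congrArg (fun q : {et : Literature.MathematicalPhysics.QuantumLattice.ZdEdge 3 // Literature.MathematicalPhysics.QuantumLattice.torusEdge L et = (x, i)} => q.1.1) h
    exact smul_right_injective _ hL (add_left_cancel h1)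
  have hsurj : Function.Surjective g := by
    rintro ⟨⟨y, i'⟩, hy⟩
    have hy' : Literature.Probability.LatticeModels.Torus.proj L y = x ∧ i' = i := Prod.ext_iff.1 hy
    have hdvd : ∀ m, (L : ℤ) ∣ y m - yt m := fun m => by
      have h1 : ((y m : ℤ) : ZMod L) = ((yt m : ℤ) : ZMod L) := by
        have := congrFun hy'.1 m
        rw [← hyt] at this
        simpa using this
      exact (ZMod.intCast_eq_intCast_iff_dvd_sub (yt m) (y m) L).1 h1.symm
    refine ⟨fun m => (y m - yt m) / L, Subtype.ext (Prod.ext ?_ hy'.2.symm)⟩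
    funext m
    show yt m + (L : ℤ) * ((y m - yt m) / L) = y m
    rw [Int.mul_ediv_cancel' (hdvd m)]; ring
  let σ : (Fin 3 → ℤ) ≃ {et : Literature.MathematicalPhysics.QuantumLattice.ZdEdge 3 // Literature.MathematicalPhysics.QuantumLattice.torusEdge L et = (x, i)} := Equiv.ofBijective g ⟨hinj, hsurj⟩
  refine ⟨?_, ?_⟩
  · exact (Equiv.tsum_eq σ (fun et : {et : Literature.MathematicalPhysics.QuantumLattice.ZdEdge 3 // Literature.MathematicalPhysics.QuantumLattice.torusEdge L et = (x, i)} => f et.1)).symm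
  · exact (Equiv.summable_iff σ (f := fun et : {et : Literature.MathematicalPhysics.QuantumLattice.ZdEdge 3 // Literature.MathematicalPhysics.QuantumLattice.torusEdge L et = (x, i)} => f et.1)).symm

/-! ## §4. The torus weights `w_e = Σ_(et ↦ e) a^(−|et|)` -/

omit [NeZero L] in
/-- The fibre series of the weight converges. [cite: ShenZhuZhuCMP2023, (1.4)] -/
theorem torusWeight_summable {a : ℝ} (ha : 1 < a) (e : Edge 3 L) : Summable (fun et : {et : Literature.MathematicalPhysics.QuantumLattice.ZdEdge 3 // Literature.MathematicalPhysics.QuantumLattice.torusEdge L et = e} => (a ^ edgeLevel et.1)⁻¹) :=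
  (summable_inv_pow_edgeLevel ha).subtype _

/-- ★★ **The torus weights are positive.** [cite: ShenZhuZhuCMP2023, (1.4)] -/
theorem torusWeight_pos {a : ℝ} (ha : 1 < a) (e : Edge 3 L) : 0 < (∑' et : {et : Literature.MathematicalPhysics.QuantumLattice.ZdEdge 3 // Literature.MathematicalPhysics.QuantumLattice.torusEdge L et = e}, (a ^ edgeLevel et.1)⁻¹) := by
  have ha0 : 0 < a := by linarith
  have hmem : Literature.MathematicalPhysics.QuantumLattice.torusEdge L ((fun m => ((e.1 m).val : ℤ)), e.2) = e := by
    show (Literature.Probability.LatticeModels.Torus.proj L (fun m => ((e.1 m).val : ℤ)), e.2) = e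
    rw [proj_lift_val]
  exact (torusWeight_summable ha e).tsum_pos (fun et => inv_nonneg.2 (pow_nonneg ha0.le _)) ⟨_, hmem⟩ (inv_pos.2 (pow_pos ha0 _))

/-- Termwise comparison of two lift series: `|et'_k| ≤ |et_k| + 1` for all `k` ⇒ `Σ_k a^(−|et_k|) ≤ a·Σ_k a^(−|et'_k|)`. [cite: ShenZhuZhuCMP2023, (3.6)] -/
theorem tsum_inv_pow_le_mul_of_level_le {a : ℝ} (ha : 1 < a) {E E' : (Fin 3 → ℤ) → Literature.MathematicalPhysics.QuantumLattice.ZdEdge 3}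
    (hE : Summable (fun k => (a ^ edgeLevel (E k))⁻¹)) (hE' : Summable (fun k => (a ^ edgeLevel (E' k))⁻¹))
    (hle : ∀ k, edgeLevel (E' k) ≤ edgeLevel (E k) + 1) :
    (∑' k, (a ^ edgeLevel (E k))⁻¹) ≤ a * ∑' k, (a ^ edgeLevel (E' k))⁻¹ := by
  have ha0 : 0 < a := by linarith
  rw [← tsum_mul_left]
  refine hE.tsum_le_tsum (fun k => ?_) (hE'.mul_left a)
  have hpow : a ^ edgeLevel (E' k) ≤ a ^ (edgeLevel (E k) + 1) := pow_le_pow_right₀ ha.le (hle k)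
  have h1 : (a ^ edgeLevel (E k))⁻¹ = a * (a ^ (edgeLevel (E k) + 1))⁻¹ := by
    rw [pow_succ, mul_inv, ← mul_assoc, mul_comm a, mul_assoc, mul_inv_cancel₀ ha0.ne', mul_one]
  rw [h1]
  exact mul_le_mul_of_nonneg_left (inv_anti₀ (pow_pos ha0 _) hpow) ha0.le

/-- ★★ **Plaquette comparability of the torus weights**: `w_e ≤ a·w_(e')` whenever `e, e'` lie on a common plaquette of `(ℤ/L)³` (fibrewise, the
lifts of the plaquette are unit squares, `edgeLevel_square`). [cite: ShenZhuZhuCMP2023, (3.6)] -/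
theorem torusWeight_plaquette_le {a : ℝ} (ha : 1 < a) (p : Plaquette 3 L) (e e' : Edge 3 L)
    (he : e ∈ ({(p.1, p.2.1.1), (p.1.shift p.2.1.1, p.2.1.2), (p.1.shift p.2.1.2, p.2.1.1), (p.1, p.2.1.2)} : Finset (Edge 3 L))) (he' : e' ∈ ({(p.1, p.2.1.1), (p.1.shift p.2.1.1, p.2.1.2), (p.1.shift p.2.1.2, p.2.1.1), (p.1, p.2.1.2)} : Finset (Edge 3 L))) : (∑' et : {et : Literature.MathematicalPhysics.QuantumLattice.ZdEdge 3 // Literature.MathematicalPhysics.QuantumLattice.torusEdge L et = e}, (a ^ edgeLevel et.1)⁻¹) ≤ a * (∑' et : {et : Literature.MathematicalPhysics.QuantumLattice.ZdEdge 3 // Literature.MathematicalPhysics.QuantumLattice.torusEdge L et = e'}, (a ^ edgeLevel et.1)⁻¹) := by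
  obtain ⟨x, ⟨⟨i, j⟩, hij⟩⟩ := p
  simp only [Finset.mem_insert, Finset.mem_singleton] at he he'
  -- the canonical lift of `x` and the base lifts of the four edges
  obtain ⟨xt, hxt0⟩ : ∃ xt : (Fin 3 → ℤ), xt = fun m => ((x m).val : ℤ) := ⟨_, rfl⟩
  have hxt : Literature.Probability.LatticeModels.Torus.proj L xt = x := by rw [hxt0]; exact proj_lift_val x
  have hxti : Literature.Probability.LatticeModels.Torus.proj L (xt + Pi.single i 1) = x.shift i := by rw [proj_add_single, hxt]
  have hxtj : Literature.Probability.LatticeModels.Torus.proj L (xt + Pi.single j 1) = x.shift j := by rw [proj_add_single, hxt]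
  have hf := summable_inv_pow_edgeLevel ha
  obtain ⟨r1, s1⟩ := tsum_fibre_eq_tsum_lifts (fun et => (a ^ edgeLevel et)⁻¹) x i xt hxt
  obtain ⟨r2, s2⟩ := tsum_fibre_eq_tsum_lifts (fun et => (a ^ edgeLevel et)⁻¹) (x.shift i) j (xt + Pi.single i 1) hxti
  obtain ⟨r3, s3⟩ := tsum_fibre_eq_tsum_lifts (fun et => (a ^ edgeLevel et)⁻¹) (x.shift j) i (xt + Pi.single j 1) hxtj
  obtain ⟨r4, s4⟩ := tsum_fibre_eq_tsum_lifts (fun et => (a ^ edgeLevel et)⁻¹) x j xt hxt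
  have t1 := s1.1 (hf.subtype _)
  have t2 := s2.1 (hf.subtype _)
  have t3 := s3.1 (hf.subtype _)
  have t4 := s4.1 (hf.subtype _)
  have hsq : ∀ k : (Fin 3 → ℤ),
      (edgeLevel (((xt + (L : ℤ) • k, i)) : Literature.MathematicalPhysics.QuantumLattice.ZdEdge 3) ≤ edgeLevel (((xt + Pi.single i 1 + (L : ℤ) • k, j)) : Literature.MathematicalPhysics.QuantumLattice.ZdEdge 3) + 1 ∧
        edgeLevel (((xt + (L : ℤ) • k, i)) : Literature.MathematicalPhysics.QuantumLattice.ZdEdge 3) ≤ edgeLevel (((xt + Pi.single j 1 + (L : ℤ) • k, i)) : Literature.MathematicalPhysics.QuantumLattice.ZdEdge 3) + 1 ∧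
        edgeLevel (((xt + (L : ℤ) • k, i)) : Literature.MathematicalPhysics.QuantumLattice.ZdEdge 3) ≤ edgeLevel (((xt + (L : ℤ) • k, j)) : Literature.MathematicalPhysics.QuantumLattice.ZdEdge 3) + 1) ∧
      (edgeLevel (((xt + Pi.single i 1 + (L : ℤ) • k, j)) : Literature.MathematicalPhysics.QuantumLattice.ZdEdge 3) ≤ edgeLevel (((xt + (L : ℤ) • k, i)) : Literature.MathematicalPhysics.QuantumLattice.ZdEdge 3) + 1 ∧
        edgeLevel (((xt + Pi.single i 1 + (L : ℤ) • k, j)) : Literature.MathematicalPhysics.QuantumLattice.ZdEdge 3) ≤ edgeLevel (((xt + Pi.single j 1 + (L : ℤ) • k, i)) : Literature.MathematicalPhysics.QuantumLattice.ZdEdge 3) + 1 ∧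
        edgeLevel (((xt + Pi.single i 1 + (L : ℤ) • k, j)) : Literature.MathematicalPhysics.QuantumLattice.ZdEdge 3) ≤ edgeLevel (((xt + (L : ℤ) • k, j)) : Literature.MathematicalPhysics.QuantumLattice.ZdEdge 3) + 1) ∧
      (edgeLevel (((xt + Pi.single j 1 + (L : ℤ) • k, i)) : Literature.MathematicalPhysics.QuantumLattice.ZdEdge 3) ≤ edgeLevel (((xt + (L : ℤ) • k, i)) : Literature.MathematicalPhysics.QuantumLattice.ZdEdge 3) + 1 ∧
        edgeLevel (((xt + Pi.single j 1 + (L : ℤ) • k, i)) : Literature.MathematicalPhysics.QuantumLattice.ZdEdge 3) ≤ edgeLevel (((xt + Pi.single i 1 + (L : ℤ) • k, j)) : Literature.MathematicalPhysics.QuantumLattice.ZdEdge 3) + 1 ∧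
        edgeLevel (((xt + Pi.single j 1 + (L : ℤ) • k, i)) : Literature.MathematicalPhysics.QuantumLattice.ZdEdge 3) ≤ edgeLevel (((xt + (L : ℤ) • k, j)) : Literature.MathematicalPhysics.QuantumLattice.ZdEdge 3) + 1) ∧
      (edgeLevel (((xt + (L : ℤ) • k, j)) : Literature.MathematicalPhysics.QuantumLattice.ZdEdge 3) ≤ edgeLevel (((xt + (L : ℤ) • k, i)) : Literature.MathematicalPhysics.QuantumLattice.ZdEdge 3) + 1 ∧
        edgeLevel (((xt + (L : ℤ) • k, j)) : Literature.MathematicalPhysics.QuantumLattice.ZdEdge 3) ≤ edgeLevel (((xt + Pi.single i 1 + (L : ℤ) • k, j)) : Literature.MathematicalPhysics.QuantumLattice.ZdEdge 3) + 1 ∧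
        edgeLevel (((xt + (L : ℤ) • k, j)) : Literature.MathematicalPhysics.QuantumLattice.ZdEdge 3) ≤ edgeLevel (((xt + Pi.single j 1 + (L : ℤ) • k, i)) : Literature.MathematicalPhysics.QuantumLattice.ZdEdge 3) + 1) := by
    intro k
    rw [add_right_comm xt (Pi.single i 1) ((L : ℤ) • k), add_right_comm xt (Pi.single j 1) ((L : ℤ) • k)]
    exact edgeLevel_square (xt + (L : ℤ) • k) i j
  have ha1 : ∀ s : ℝ, 0 ≤ s → s ≤ a * s := fun s hs => by nlinarith
  have hnn : ∀ E : Edge 3 L, 0 ≤ (∑' et : {et : Literature.MathematicalPhysics.QuantumLattice.ZdEdge 3 // Literature.MathematicalPhysics.QuantumLattice.torusEdge L et = E}, (a ^ edgeLevel et.1)⁻¹) :=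
    fun E => tsum_nonneg fun et => inv_nonneg.2 (pow_nonneg (by linarith) _)
  rcases he with rfl | rfl | rfl | rfl <;> rcases he' with rfl | rfl | rfl | rfl
  · exact ha1 _ (hnn _)
  · rw [r1, r2]; exact tsum_inv_pow_le_mul_of_level_le ha t1 t2 fun k => (hsq k).2.1.1
  · rw [r1, r3]; exact tsum_inv_pow_le_mul_of_level_le ha t1 t3 fun k => (hsq k).2.2.1.1
  · rw [r1, r4]; exact tsum_inv_pow_le_mul_of_level_le ha t1 t4 fun k => (hsq k).2.2.2.1
  · rw [r2, r1]; exact tsum_inv_pow_le_mul_of_level_le ha t2 t1 fun k => (hsq k).1.1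
  · exact ha1 _ (hnn _)
  · rw [r2, r3]; exact tsum_inv_pow_le_mul_of_level_le ha t2 t3 fun k => (hsq k).2.2.1.2.1
  · rw [r2, r4]; exact tsum_inv_pow_le_mul_of_level_le ha t2 t4 fun k => (hsq k).2.2.2.2.1
  · rw [r3, r1]; exact tsum_inv_pow_le_mul_of_level_le ha t3 t1 fun k => (hsq k).1.2.1
  · rw [r3, r2]; exact tsum_inv_pow_le_mul_of_level_le ha t3 t2 fun k => (hsq k).2.1.2.1
  · exact ha1 _ (hnn _)
  · rw [r3, r4]; exact tsum_inv_pow_le_mul_of_level_le ha t3 t4 fun k => (hsq k).2.2.2.2.2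
  · rw [r4, r1]; exact tsum_inv_pow_le_mul_of_level_le ha t4 t1 fun k => (hsq k).1.2.2
  · rw [r4, r2]; exact tsum_inv_pow_le_mul_of_level_le ha t4 t2 fun k => (hsq k).2.1.2.2
  · rw [r4, r3]; exact tsum_inv_pow_le_mul_of_level_le ha t4 t3 fun k => (hsq k).2.2.1.2.2
  · exact ha1 _ (hnn _)

/-! ## §5. `ρ_(∞,a)` of two periodic configurations regroups along the fibres -/

/-- ★★ **`ρ_(∞,a)(torusLift U, torusLift U')² = Σ_e w_e·ρ(U_e,U'_e)²`** with `w_e = Σ_(torusEdge et = e) a^(−|et|)`, for `a > 1` and any lattice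
representation `r` (the `tsum` over `E⁺(ℤ³)` converges and regroups along `torusEdge L`). [cite: ShenZhuZhuCMP2023, Lemma 5.1] -/
theorem weightedRiemannDistSq_torusLift_eq {G : Type*} [Group G] [TopologicalSpace G] (r : LatticeRep G) {a : ℝ} (ha : 1 < a)
    (U U' : GaugeConfig 3 L G) :
    weightedRiemannDistSq r a (Literature.MathematicalPhysics.QuantumLattice.torusLift L U) (Literature.MathematicalPhysics.QuantumLattice.torusLift L U') =
      ∑ e : Edge 3 L, (∑' et : {et : Literature.MathematicalPhysics.QuantumLattice.ZdEdge 3 // Literature.MathematicalPhysics.QuantumLattice.torusEdge L et = e}, (a ^ edgeLevel et.1)⁻¹) * r.riemannDist (U e) (U' e) ^ 2 := by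
  classical
  have ha0 : 0 < a := by linarith
  unfold weightedRiemannDistSq
  -- the summand and its summability
  obtain ⟨F, hF⟩ : ∃ F : Literature.MathematicalPhysics.QuantumLattice.ZdEdge 3 → ℝ, F = fun et => (a ^ edgeLevel et)⁻¹ * r.riemannDist (Literature.MathematicalPhysics.QuantumLattice.torusLift L U et) (Literature.MathematicalPhysics.QuantumLattice.torusLift L U' et) ^ 2 := ⟨_, rfl⟩
  have hFe : ∀ et : Literature.MathematicalPhysics.QuantumLattice.ZdEdge 3, F et = (a ^ edgeLevel et)⁻¹ * r.riemannDist (U (Literature.MathematicalPhysics.QuantumLattice.torusEdge L et)) (U' (Literature.MathematicalPhysics.QuantumLattice.torusEdge L et)) ^ 2 := fun et => by rw [hF]; rfl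
  have hC : ∀ e : Edge 3 L, r.riemannDist (U e) (U' e) ^ 2 ≤ torusRiemannDistSq r U U' := fun e =>
    Finset.single_le_sum (f := fun e' : Edge 3 L => r.riemannDist (U e') (U' e') ^ 2) (fun _ _ => sq_nonneg _) (Finset.mem_univ e)
  have hF0 : ∀ et, 0 ≤ F et := fun et => by rw [hFe]; exact mul_nonneg (inv_nonneg.2 (pow_nonneg ha0.le _)) (sq_nonneg _)
  have hFsum : Summable F :=
    Summable.of_nonneg_of_le hF0 (fun et => by rw [hFe]; exact mul_le_mul_of_nonneg_left (hC _) (inv_nonneg.2 (pow_nonneg ha0.le _)))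
      ((summable_inv_pow_edgeLevel ha).mul_right _)
  rw [show (fun et : Literature.MathematicalPhysics.QuantumLattice.ZdEdge 3 => (a ^ edgeLevel et)⁻¹ * r.riemannDist (Literature.MathematicalPhysics.QuantumLattice.torusLift L U et) (Literature.MathematicalPhysics.QuantumLattice.torusLift L U' et) ^ 2) = F from hF.symm]
  -- regroup along the fibration `torusEdge L`
  have h1 : ∑' et, F et = ∑' q : (Σ e : Edge 3 L, {et : Literature.MathematicalPhysics.QuantumLattice.ZdEdge 3 // Literature.MathematicalPhysics.QuantumLattice.torusEdge L et = e}), F q.2.1 :=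
    (Equiv.tsum_eq (Equiv.sigmaFiberEquiv (Literature.MathematicalPhysics.QuantumLattice.torusEdge L)) F).symm
  have h2 : ∑' q : (Σ e : Edge 3 L, {et : Literature.MathematicalPhysics.QuantumLattice.ZdEdge 3 // Literature.MathematicalPhysics.QuantumLattice.torusEdge L et = e}), F q.2.1 = ∑' e : Edge 3 L, ∑' et : {et : Literature.MathematicalPhysics.QuantumLattice.ZdEdge 3 // Literature.MathematicalPhysics.QuantumLattice.torusEdge L et = e}, F et.1 :=
    Summable.tsum_sigma' (fun e => hFsum.subtype _) ((Equiv.summable_iff (Equiv.sigmaFiberEquiv (Literature.MathematicalPhysics.QuantumLattice.torusEdge L))).2 hFsum)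
  rw [h1, h2, tsum_fintype]
  refine Finset.sum_congr rfl fun e _ => ?_
  have h3 : (fun et : {et : Literature.MathematicalPhysics.QuantumLattice.ZdEdge 3 // Literature.MathematicalPhysics.QuantumLattice.torusEdge L et = e} => F et.1) = fun et : {et : Literature.MathematicalPhysics.QuantumLattice.ZdEdge 3 // Literature.MathematicalPhysics.QuantumLattice.torusEdge L et = e} => (a ^ edgeLevel et.1)⁻¹ * r.riemannDist (U e) (U' e) ^ 2 := by
    funext et; rw [hFe, et.2]
  rw [h3, tsum_mul_right]

end Summit.QuantumFields.YangMills.Theorems.ColdStartUniversality
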